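import Literature.IUT.HodgeTheaters.GoodLocalFrobenioidOfGaloisBaseRam
import Literature.IUT.HodgeTheaters.GaloisValDatumCoveringMonoid
import Literature.AlgebraicGeometry.Frobenioids.PadicFrobenioidSplittingTransport
import Literature.AlgebraicGeometry.Frobenioids.PadicFrobenioidThm12TypesProofs
import HarnessLib

/-!
# [IUTchI] Example 3.3 (iii) (e) over the REAL bases: the unit transport of a self-equivalence of `C_v`, read in `K̄_v`

Mochizuki, *Inter-universal Teichmüller theory I*, kurims manuscript (May 2020), Example 3.3 (iii) (e), p. 79
[claim: Mochizuki2012, status: disputed]: "(e) one may reconstruct the split Frobenioids `F⊢_v`, `F^Θ_v` category-theoretically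
from `F̲_v`" (l. 60–62; the anabelian input is print's PRECEDING sentence, l. 52–53: «by applying the algorithmically constructed field
structure on the image of the Kummer map of [AbsTopIII], Proposition 3.2, (iii) …») — nothing of the series is asserted; no
side is taken on [IUTchIII] Cor. 3.12.  Mochizuki, *The geometry of Frobenioids II*, Kyushu J. Math. **62** (2008) [page/line locators: kurims
manuscript, the cell's render of record], proof of Thm. 2.4 (ii), ms p. 20 l.−5 – p. 21 l. 6 ("by varying the objects `Aᵢ` … `Ψ` induces a
pair of compatible isomorphisms `G₁ ⥲ G₂`; `K̄₁^× ⥲ K̄₂^×`") [cite: MochizukiFrdII2008, proof of Thm 2.4 (ii) ms p.21].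

PROOF-ONLY file (abc-iut cell, seat abc-iut-L5-t16 gen 7; row E33iii/e «hfix at the genuine datum», piece (F3a)), no
definitions, no new `Prop`.  Setting (all data are HYPOTHESES here, theorems of the tree at the genuine datum): a `p`-adic
Frobenioid datum `Q` over the REAL base `D_v = CosetCat Π_v` whose fields are read in `Ω = K̄_v` by injective ring
homomorphisms `ε_A` turning the base arrow with point `g` into `x ↦ aug(g)·x`; a self-equivalence `Ψ` of `C_v` with [FrdI]
Cor. 4.11 (iv) base data `(Ψ^Base, η, hdeg)` and components `e_X : Ψ^Base(Base X) → Base(Ψ X)` natural in `X`; abc-iut-L1's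
STRAIGHTENING of `Ψ^Base` along a Galois tower `(Π_v/N_k)_k`: `j_k : Π_v/N₂,k → Ψ^Base(Π_v/N_k)` natural in `k` and `φ` with
`Ψ^Base(r_g) ∘ j_k = j_k ∘ r_{φ g}` (`BaseGaloisSystem.exists_mulEquiv_compatible_of_cosetCat_equivalence`).  For a tower object
`X_k = (Π_v/N_k, c)` and `w ∈ O^▷(X_k)`, the READING of `w` is `ε((j_k ≫ e)^*(u_{Ψ w}|_{K^×})) ∈ Ω` — the unit transport of
`Ψ` read in `K̄_v`.  We prove: `reading_natural` (the one computation: rational functions of restrictions along LINEAR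
morphisms, abc-iut-L5-t16's `resK_unit_map_eq_of_comp_eq`, moved through `e` and base morphisms); `reading_eq_of_le` /
`reading_eq_of_eps_eq` (independence of the level: lifts `(1, π, 0, 1)` of the projections, whose field maps are
inclusions); `reading_smul` (**`φ`-SEMILINEARITY** `reading(aug(g)·x) = aug(φ g)·reading(x)`: lifts of the deck
transformations `r_g` — `Φ(r_g) = id` by [FrdII] Thm. 1.2 (i), `Datum.endTrivial`); `reading_mul`, `eq_of_reading_eq`; `resK_unit_map_eq_pow_iff` (the link with an arbitrary object `X` through
`X_k = (Π_v/N_k, π_k^* cls X) → X`).  (Valuations — units ↔ units, the generator goes to `p·(unit)` — are in the sequel.)  These are the Frobenioid-side inputs ((E1) of abc-iut-L5-lead RULINGS #80) of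
clause (e); the anabelian input (E2) and the Kummer rigidity (E3) are consumed in the sequel.
-/


noncomputable section

namespace Literature.IUT.HodgeTheaters

namespace GoodLocalFrobenioid

open CategoryTheory Opposite Function ValuativeRel Literature.AnabelianGeometry.SemiGraphs
open Literature.AlgebraicGeometry.Frobenioids Literature.AlgebraicGeometry.Frobenioids.PadicFrd
open Literature.AlgebraicGeometry.Frobenioids.BaseGaloisSystem

universe u

namespace UnitTransport

variable {p : ℕ} [Fact p.Prime] (d : GaloisValDatum.{u} p) {P : Type u} [Group P] [TopologicalSpace P]
  (aug : P →* d.Gal) (ho : IsOpenMap aug)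

/-! ### The tower objects `X_k = (Π_v/N_k, π_k^* cls X)` and their linear lifts -/

/-- The projection `Π_v/N → Base(X)` for `N ⊆ Base(X)` (point `1`). [cite: MochizukiFrdII2008, Ex 1.3 (i) p.11] -/
theorem proj_wd (X : CosetCat P) (N : OpenNormalSubgroup P) (hN : N.toOpenSubgroup ≤ X.sg) :
    ∀ u ∈ (cQ N).sg, u • ((1 : P) : X.carrier) = ((1 : P) : X.carrier) := fun u hu =>
  (CosetCat.smul_one_eq_one_iff X u).mpr (hN hu)

/-- Pulling back classes is insensitive to deck transformations: `Φ(r) = id` for every endomorphism `r` of an object of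
the base ([FrdII] Thm. 1.2 (i) "`End_D(A_D)` acts trivially on `Φ(A_D)`", abc-iut-L1's `Datum.endTrivial`).
[cite: MochizukiFrdII2008, Thm 1.2 (i) p.9] -/
theorem pullGp_endo {D : Type u} [Category.{u} D] (Q : Datum D p) {A : D} (r : A ⟶ A)
    (c : Algebra.GrothendieckGroup (Q.Φ.obj (op A))) : pullGp Q.Φ r c = c := by
  change MonGp.map (Q.Φ.map r.op).hom c = c
  rw [Q.endTrivial r, CommMonCat.hom_id, MonGp.map_id, MonoidHom.id_apply]

/-- The relation (d) of [FrdI] Thm. 5.2 (i) for a linear lift `(1, f, 0, 1) : (A, f^* β) → (B, β)`.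
[cite: MochizukiFrdI2008, Thm. 5.2(i) p.100] -/
theorem lift_rel {D : Type u} [Category.{u} D] (Q : Datum D p) {A : D} (Y : Q.frobenioid) (f : A ⟶ Y.base)
    (c : Algebra.GrothendieckGroup (Q.Φ.obj (op A))) (hc : c = pullGp Q.Φ f Y.cls) :
    (⟨A, c⟩ : Q.frobenioid).cls ^ ((1 : ℕ+) : ℕ) * Algebra.GrothendieckGroup.of (1 : Q.Φ.obj (op A)) =
      pullGp Q.Φ f Y.cls * Literature.AlgebraicGeometry.Frobenioids.divB Q.Φ Q.B Q.divB (op A) 1 := by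
  rw [PNat.one_coe, pow_one, map_one, mul_one, map_one, mul_one]
  exact hc

/-- A linear lift `(1, f, 0, 1)` is linear. [cite: MochizukiFrdI2008, Thm. 5.2(i) p.100] -/
theorem isLinear_mkHom_one {D : Type u} [Category.{u} D] (Q : Datum D p) {X Y : Q.frobenioid} (f : X.base ⟶ Y.base)
    (x : Q.Φ.obj (op X.base)) (v : Q.B.obj (op X.base)) (h) :
    PreFrobenioid.IsLinear Q.structureFunctor (ModelFrobenioid.mkHom X Y 1 f x v h) := rfl

/-! ### Restriction of `O^▷(−)` along a linear morphism: existence and the rational function -/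

/-- **Restriction along a linear morphism.**  For a linear `φ : A → B` and `β ∈ O^▷(B)` there is `α ∈ O^▷(A)` with
`β ∘ φ = φ ∘ α`, and its rational function is `σ_φ(u_β|_{K^×})` ([FrdI] Def. 2.3 subfunctoriality; abc-iut-L1-t4's
`exists_comp_eq_of_isLinear'` with abc-iut-L5-t16's `resK_unit_eq_of_comp_eq`). [cite: MochizukiFrdII2008, Thm 1.2 (v) p.10] -/
theorem exists_restrict {D : Type u} [Category.{u} D] (Q : Datum D p) {X Y : Q.frobenioid} (φ : X ⟶ Y)
    (hφ : PreFrobenioid.IsLinear Q.structureFunctor φ) {β : Y ⟶ Y}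
    (hβ : β ∈ PreFrobenioid.endSubmonoid Q.structureFunctor Y) :
    ∃ α : X ⟶ X, α ∈ PreFrobenioid.endSubmonoid Q.structureFunctor X ∧ φ ≫ β = α ≫ φ ∧
      Q.resK X.base (ModelFrobenioid.unit α) =
        Units.map ((Q.base.map (ModelFrobenioid.baseMap φ)).alg : Q.fld Y.base →* Q.fld X.base)
          (Q.resK Y.base (ModelFrobenioid.unit β)) := by
  obtain ⟨α, hα, h⟩ := Q.exists_comp_eq_of_isLinear' φ hφ (β := End.of β) hβ
  exact ⟨End.asHom α, hα, h, Q.resK_unit_eq_of_comp_eq φ hφ hβ hα h⟩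

/-! ### The unit transport of `Ψ`, read through base morphisms: naturality -/

section Reading

variable {D : Type u} [Category.{u} D] (Q : Datum D p) (Ψ : Q.frobenioid ≌ Q.frobenioid) (ΨBase : D ⥤ D)
  (η : Ψ.functor ⋙ (ModelFrobenioid.data Q.Φ Q.B Q.divB).base ≅ (ModelFrobenioid.data Q.Φ Q.B Q.divB).base ⋙ ΨBase)
  (hdeg : ∀ ⦃X Y : Q.frobenioid⦄ (φ : X ⟶ Y), ModelFrobenioid.degFr (Ψ.functor.map φ) = ModelFrobenioid.degFr φ)
  (e : ∀ X : Q.frobenioid, ΨBase.obj X.base ⟶ (Ψ.functor.obj X).base)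
  (he : ∀ ⦃Z Y : Q.frobenioid⦄ (lam : Z ⟶ Y),
    ΨBase.map (ModelFrobenioid.baseMap lam) ≫ e Y = e Z ≫ ModelFrobenioid.baseMap (Ψ.functor.map lam))

/-- The components `η⁻¹_X : Ψ^Base(Base X) → Base(Ψ X)` of the base datum satisfy the naturality `he` used below
(`Ψ^Base(Base λ) ≫ η⁻¹_Y = η⁻¹_Z ≫ Base(Ψ λ)`). [cite: MochizukiFrdI2008, Cor. 4.11 (iv) p.92] -/
theorem eta_inv_naturality {Z Y : Q.frobenioid} (lam : Z ⟶ Y) :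
    ΨBase.map (ModelFrobenioid.baseMap lam) ≫ (η.inv.app Y : ΨBase.obj Y.base ⟶ (Ψ.functor.obj Y).base) =
      (η.inv.app Z : ΨBase.obj Z.base ⟶ (Ψ.functor.obj Z).base) ≫ ModelFrobenioid.baseMap (Ψ.functor.map lam) :=
  η.inv.naturality lam

include η hdeg he in
/-- **Naturality of the unit transport read through base morphisms.**  Let `λ : Z → Y` be linear, `β ∈ O^▷(Y)` with
restriction `α ∈ O^▷(Z)` (`β ∘ λ = λ ∘ α`), and let `t_Z : S → Ψ^Base(Base Z)`, `t_Y : T → Ψ^Base(Base Y)`, `m : S → T` be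
base morphisms with `t_Z ≫ Ψ^Base(Base λ) = m ≫ t_Y`.  Then, reading rational functions through `t ≫ e` (`e = η⁻¹`),
`(t_Z ≫ e_Z)^*(u_{Ψα}) = m^*((t_Y ≫ e_Y)^*(u_{Ψβ}))` — the rational function of `Ψα` is that of `Ψβ` moved along `Base(Ψλ)`
(abc-iut-L5-t16's `resK_unit_map_eq_of_comp_eq`), and `Base(Ψλ) ∘ e_Z = e_Y ∘ Ψ^Base(Base λ)`.
[cite: MochizukiFrdI2008, Cor. 4.11 (iv) p.92] -/
theorem reading_natural [ΨBase.Faithful] {Z Y : Q.frobenioid} (lam : Z ⟶ Y)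
    (hlam : PreFrobenioid.IsLinear Q.structureFunctor lam) {β : Y ⟶ Y}
    (hβ : β ∈ PreFrobenioid.endSubmonoid Q.structureFunctor Y) {α : Z ⟶ Z}
    (hα : α ∈ PreFrobenioid.endSubmonoid Q.structureFunctor Z) (h : lam ≫ β = α ≫ lam)
    {S T : D} (tZ : S ⟶ ΨBase.obj Z.base) (tY : T ⟶ ΨBase.obj Y.base) (m : S ⟶ T)
    (hm : tZ ≫ ΨBase.map (ModelFrobenioid.baseMap lam) = m ≫ tY) :
    (Q.base.map (tZ ≫ e Z)).alg
        ((Q.resK _ (ModelFrobenioid.unit (Ψ.functor.map α)) : (Q.fld (Ψ.functor.obj Z).base)ˣ) : Q.fld (Ψ.functor.obj Z).base) =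
      (Q.base.map m).alg ((Q.base.map (tY ≫ e Y)).alg
        ((Q.resK _ (ModelFrobenioid.unit (Ψ.functor.map β)) : (Q.fld (Ψ.functor.obj Y).base)ˣ) : Q.fld (Ψ.functor.obj Y).base)) := by
  have hu := Q.resK_unit_map_eq_of_comp_eq Ψ ΨBase η hdeg lam hlam hβ hα h
  have hbase : tZ ≫ e Z ≫ ModelFrobenioid.baseMap (Ψ.functor.map lam) = m ≫ tY ≫ e Y := by
    rw [← he lam, ← Category.assoc, hm, Category.assoc]
  rw [hu, Units.coe_map, MonoidHom.coe_coe, ← RingHom.comp_apply, ← PadicFld.comp_alg, ← Functor.map_comp,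
    Category.assoc, hbase]
  simp only [Functor.map_comp, PadicFld.comp_alg, RingHom.comp_apply]

end Reading

/-! ### The tower over `D_v = CosetCat Π_v`: level independence, multiplicativity, semilinearity -/

section Tower

variable {p : ℕ} [Fact p.Prime] (d : GaloisValDatum.{u} p) {P : Type u} [Group P] [TopologicalSpace P]
  (aug : P →* d.Gal) (Q : Datum (CosetCat P) p)
  -- reading the fields of the base in `Ω = K̄_v`
  (ε : ∀ A : CosetCat P, Q.fld A →+* d.Ω) (hεi : ∀ A, Injective (ε A))
  (hε : ∀ ⦃A B : CosetCat P⦄ (f : A ⟶ B) (g : P), CosetCat.pt f = ((g : P) : B.carrier) →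
    ∀ y : Q.fld B, ε A ((Q.base.map f).alg y) = (aug g) (ε B y))
  -- the self-equivalence and its [FrdI] Cor. 4.11 (iv) base data
  (Ψ : Q.frobenioid ≌ Q.frobenioid) (ΨBase : CosetCat P ⥤ CosetCat P)
  (η : Ψ.functor ⋙ (ModelFrobenioid.data Q.Φ Q.B Q.divB).base ≅ (ModelFrobenioid.data Q.Φ Q.B Q.divB).base ⋙ ΨBase)
  (hdeg : ∀ ⦃X Y : Q.frobenioid⦄ (φ : X ⟶ Y), ModelFrobenioid.degFr (Ψ.functor.map φ) = ModelFrobenioid.degFr φ)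
  (e : ∀ X : Q.frobenioid, ΨBase.obj X.base ⟶ (Ψ.functor.obj X).base)
  (he : ∀ ⦃Z Y : Q.frobenioid⦄ (lam : Z ⟶ Y),
    ΨBase.map (ModelFrobenioid.baseMap lam) ≫ e Y = e Z ≫ ModelFrobenioid.baseMap (Ψ.functor.map lam))
  -- the straightening of `Ψ^Base` along a Galois tower
  (N N₂ : ℕ → OpenNormalSubgroup P) (hN : Antitone N) (hN₂ : Antitone N₂)
  (j : ∀ k, cQ (N₂ k) ⟶ ΨBase.obj (cQ (N k)))
  (hj : ∀ ⦃k k' : ℕ⦄ (h : k ≤ k'), j k' ≫ ΨBase.map (cproj (hN h)) = cproj (hN₂ h) ≫ j k)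
  (φ : P → P) (hφ : ∀ (k : ℕ) (g : P), crightMul (N₂ k) (φ g) ≫ j k = j k ≫ ΨBase.map (crightMul (N k) g))

include hε in
/-- Field maps of base arrows with point `1` (the tower's projections) are INCLUSIONS in `Ω`.
[cite: MochizukiFrdII2008, Ex 1.3 (i) p.11] -/
theorem eps_map_of_pt_one {A B : CosetCat P} (f : A ⟶ B) (hf : CosetCat.pt f = ((1 : P) : B.carrier)) (y : Q.fld B) :
    ε A ((Q.base.map f).alg y) = ε B y := by
  rw [hε f 1 hf, map_one, AlgEquiv.one_apply]

include hεi hε in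
/-- **Restrictions are pinned by their rational function read in `Ω`**: if `λ : Z → Y` is linear with `Base λ` of point
`g`, `β ∈ O^▷(Y)` and `α ∈ O^▷(Z)` has `ε(u_α) = aug(g)·ε(u_β)`, then `β ∘ λ = λ ∘ α` (uniqueness of the restriction,
abc-iut-L5-t16's `eq_of_mem_of_resK_unit_eq`). [cite: MochizukiFrdII2008, Thm 1.2 (v) p.10] -/
theorem comp_eq_of_eps_eq {Z Y : Q.frobenioid} (lam : Z ⟶ Y) (hlam : PreFrobenioid.IsLinear Q.structureFunctor lam)
    (g : P) (hg : CosetCat.pt (ModelFrobenioid.baseMap lam) = ((g : P) : Y.base.carrier)) {β : Y ⟶ Y}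
    (hβ : β ∈ PreFrobenioid.endSubmonoid Q.structureFunctor Y) {α : Z ⟶ Z}
    (hα : α ∈ PreFrobenioid.endSubmonoid Q.structureFunctor Z)
    (h : ε Z.base ((Q.resK _ (ModelFrobenioid.unit α) : (Q.fld Z.base)ˣ) : Q.fld Z.base) =
      (aug g) (ε Y.base ((Q.resK _ (ModelFrobenioid.unit β) : (Q.fld Y.base)ˣ) : Q.fld Y.base))) :
    lam ≫ β = α ≫ lam := by
  obtain ⟨α', hα', hsq, hres⟩ := exists_restrict Q lam hlam hβ
  have hαα' : α = α' := by
    refine Q.eq_of_mem_of_resK_unit_eq hα hα' (Units.ext (hεi _ ?_))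
    rw [h, hres, Units.coe_map, MonoidHom.coe_coe, hε _ g hg]
  rw [hαα']
  exact hsq

include hε in
/-- **Restriction along a lift of a point-`1` base arrow keeps the rational function (read in `Ω`)**: for a linear
`λ : Z → Y` whose base arrow has point `1` (a projection of the tower) and `β ∈ O^▷(Y)`, the restriction `α ∈ O^▷(Z)` has
`ε(u_α) = ε(u_β)`. [cite: MochizukiFrdII2008, Thm 1.2 (v) p.10] -/
theorem exists_restrict_of_pt_one {Z Y : Q.frobenioid} (lam : Z ⟶ Y) (hlam : PreFrobenioid.IsLinear Q.structureFunctor lam)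
    (h1 : CosetCat.pt (ModelFrobenioid.baseMap lam) = ((1 : P) : Y.base.carrier)) {β : Y ⟶ Y}
    (hβ : β ∈ PreFrobenioid.endSubmonoid Q.structureFunctor Y) :
    ∃ α : Z ⟶ Z, α ∈ PreFrobenioid.endSubmonoid Q.structureFunctor Z ∧ lam ≫ β = α ≫ lam ∧
      ε Z.base ((Q.resK _ (ModelFrobenioid.unit α) : (Q.fld Z.base)ˣ) : Q.fld Z.base) =
        ε Y.base ((Q.resK _ (ModelFrobenioid.unit β) : (Q.fld Y.base)ˣ) : Q.fld Y.base) := by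
  obtain ⟨α, hα, hsq, hres⟩ := exists_restrict Q lam hlam hβ
  refine ⟨α, hα, hsq, ?_⟩
  rw [hres, Units.coe_map, MonoidHom.coe_coe, eps_map_of_pt_one d aug Q ε hε _ h1]

include η hdeg he hε hj in
/-- **Level independence.**  For `k ≤ k'`, the reading at level `k'` of the restriction `w'` of `w ∈ O^▷(X_k)` along the
lift `(1, π, 0, 1) : X_{k'} = (Π_v/N_{k'}, π^* c) → X_k = (Π_v/N_k, c)` of the projection `π : Π_v/N_{k'} → Π_v/N_k` equals the
reading of `w` at level `k` (naturality of `e` and of the straightening `j`; the field map of `Π_v/N₂,k' → Π_v/N₂,k` is an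
inclusion). [cite: MochizukiFrdII2008, Thm 2.4 (ii) p.21] -/
theorem reading_eq_of_le [ΨBase.Faithful] {k k' : ℕ} (h : k ≤ k')
    (c : Algebra.GrothendieckGroup (Q.Φ.obj (op (cQ (N k)))))
    (c' : Algebra.GrothendieckGroup (Q.Φ.obj (op (cQ (N k'))))) (hc' : c' = pullGp Q.Φ (cproj (hN h)) c)
    {w : (⟨cQ (N k), c⟩ : Q.frobenioid) ⟶ ⟨cQ (N k), c⟩}
    (hw : w ∈ PreFrobenioid.endSubmonoid Q.structureFunctor (⟨cQ (N k), c⟩ : Q.frobenioid))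
    {w' : (⟨cQ (N k'), c'⟩ : Q.frobenioid) ⟶ ⟨cQ (N k'), c'⟩}
    (hw' : w' ∈ PreFrobenioid.endSubmonoid Q.structureFunctor (⟨cQ (N k'), c'⟩ : Q.frobenioid))
    (hsq : ModelFrobenioid.mkHom (⟨cQ (N k'), c'⟩ : Q.frobenioid) ⟨cQ (N k), c⟩ 1 (cproj (hN h)) 1 1
        (lift_rel Q ⟨cQ (N k), c⟩ (cproj (hN h)) _ hc') ≫ w =
      w' ≫ ModelFrobenioid.mkHom (⟨cQ (N k'), c'⟩ : Q.frobenioid) ⟨cQ (N k), c⟩ 1 (cproj (hN h)) 1 1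
        (lift_rel Q ⟨cQ (N k), c⟩ (cproj (hN h)) _ hc')) :
    ε (cQ (N₂ k')) ((Q.base.map (j k' ≫ e ⟨cQ (N k'), c'⟩)).alg
        ((Q.resK _ (ModelFrobenioid.unit (Ψ.functor.map w')) : (Q.fld _)ˣ) : Q.fld _)) =
      ε (cQ (N₂ k)) ((Q.base.map (j k ≫ e ⟨cQ (N k), c⟩)).alg
        ((Q.resK _ (ModelFrobenioid.unit (Ψ.functor.map w)) : (Q.fld _)ˣ) : Q.fld _)) := by
  rw [reading_natural Q Ψ ΨBase η hdeg e he _ (isLinear_mkHom_one Q _ _ _ _) hw hw' hsq (j k') (j k) (cproj (hN₂ h))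
    (hj h), eps_map_of_pt_one d aug Q ε hε _ (pt_cproj _)]

include η hdeg he hεi hε hj in
/-- **The reading depends only on the rational function read in `Ω`**: if `w₁ ∈ O^▷(X_{k₁})`, `w₂ ∈ O^▷(X_{k₂})` (levels and
classes under a common level `k₃` of the tower) have the same rational function in `Ω`, their readings agree — restrict
both to level `k₃`, where the restrictions coincide. [cite: MochizukiFrdII2008, Thm 2.4 (ii) p.21] -/
theorem reading_eq_of_eps_eq [ΨBase.Faithful] {k₁ k₂ k₃ : ℕ} (h₁ : k₁ ≤ k₃) (h₂ : k₂ ≤ k₃)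
    (c₁ : Algebra.GrothendieckGroup (Q.Φ.obj (op (cQ (N k₁)))))
    (c₂ : Algebra.GrothendieckGroup (Q.Φ.obj (op (cQ (N k₂)))))
    (c₃ : Algebra.GrothendieckGroup (Q.Φ.obj (op (cQ (N k₃)))))
    (hc₁ : c₃ = pullGp Q.Φ (cproj (hN h₁)) c₁) (hc₂ : c₃ = pullGp Q.Φ (cproj (hN h₂)) c₂)
    {w₁ : (⟨cQ (N k₁), c₁⟩ : Q.frobenioid) ⟶ ⟨cQ (N k₁), c₁⟩}
    (hw₁ : w₁ ∈ PreFrobenioid.endSubmonoid Q.structureFunctor (⟨cQ (N k₁), c₁⟩ : Q.frobenioid))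
    {w₂ : (⟨cQ (N k₂), c₂⟩ : Q.frobenioid) ⟶ ⟨cQ (N k₂), c₂⟩}
    (hw₂ : w₂ ∈ PreFrobenioid.endSubmonoid Q.structureFunctor (⟨cQ (N k₂), c₂⟩ : Q.frobenioid))
    (h : ε (cQ (N k₁)) ((Q.resK _ (ModelFrobenioid.unit w₁) : (Q.fld (cQ (N k₁)))ˣ) : Q.fld (cQ (N k₁))) =
      ε (cQ (N k₂)) ((Q.resK _ (ModelFrobenioid.unit w₂) : (Q.fld (cQ (N k₂)))ˣ) : Q.fld (cQ (N k₂)))) :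
    ε (cQ (N₂ k₁)) ((Q.base.map (j k₁ ≫ e ⟨cQ (N k₁), c₁⟩)).alg
        ((Q.resK _ (ModelFrobenioid.unit (Ψ.functor.map w₁)) : (Q.fld _)ˣ) : Q.fld _)) =
      ε (cQ (N₂ k₂)) ((Q.base.map (j k₂ ≫ e ⟨cQ (N k₂), c₂⟩)).alg
        ((Q.resK _ (ModelFrobenioid.unit (Ψ.functor.map w₂)) : (Q.fld _)ˣ) : Q.fld _)) := by
  -- restrict both to level `k₃`
  obtain ⟨w₃, hw₃, hsq₁, hε₁⟩ := exists_restrict_of_pt_one d aug Q ε hε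
    (ModelFrobenioid.mkHom (⟨cQ (N k₃), c₃⟩ : Q.frobenioid) ⟨cQ (N k₁), c₁⟩ 1 (cproj (hN h₁)) 1 1
      (lift_rel Q ⟨cQ (N k₁), c₁⟩ (cproj (hN h₁)) _ hc₁)) (isLinear_mkHom_one Q _ _ _ _) (pt_cproj (hN h₁)) hw₁
  obtain ⟨w₃', hw₃', hsq₂, hε₂⟩ := exists_restrict_of_pt_one d aug Q ε hε
    (ModelFrobenioid.mkHom (⟨cQ (N k₃), c₃⟩ : Q.frobenioid) ⟨cQ (N k₂), c₂⟩ 1 (cproj (hN h₂)) 1 1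
      (lift_rel Q ⟨cQ (N k₂), c₂⟩ (cproj (hN h₂)) _ hc₂)) (isLinear_mkHom_one Q _ _ _ _) (pt_cproj (hN h₂)) hw₂
  -- the two restrictions coincide
  have h33 : w₃ = w₃' := Q.eq_of_mem_of_resK_unit_eq hw₃ hw₃' (Units.ext (hεi _ (by rw [hε₁, hε₂, h])))
  rw [← reading_eq_of_le d aug Q ε hε Ψ ΨBase η hdeg e he N N₂ hN hN₂ j hj h₁ c₁ c₃ hc₁ hw₁ hw₃ hsq₁,
    ← reading_eq_of_le d aug Q ε hε Ψ ΨBase η hdeg e he N N₂ hN hN₂ j hj h₂ c₂ c₃ hc₂ hw₂ hw₃' hsq₂, h33]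

include η hdeg he hεi hε hφ in
/-- **`φ`-semilinearity.**  At level `k`, if `w, w' ∈ O^▷(X_k)` have rational functions `x` and `aug(g)·x` (read in `Ω`),
then the reading of `w'` is `aug(φ g)` applied to the reading of `w`: `w'` is the restriction of `w` along the lift
`(1, r_g, 0, 1)` of the deck transformation `r_g` (`Φ(r_g) = id`, [FrdII] Thm. 1.2 (i)), `Base(Ψ(lift)) = e ∘ Ψ^Base(r_g) ∘ e⁻¹`
and `Ψ^Base(r_g) = r_{φ g}` through the straightening. [cite: MochizukiFrdII2008, Thm 2.4 (ii) p.21] -/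
theorem reading_smul [ΨBase.Faithful] (k : ℕ) (c : Algebra.GrothendieckGroup (Q.Φ.obj (op (cQ (N k))))) (g : P)
    {w w' : (⟨cQ (N k), c⟩ : Q.frobenioid) ⟶ ⟨cQ (N k), c⟩}
    (hw : w ∈ PreFrobenioid.endSubmonoid Q.structureFunctor (⟨cQ (N k), c⟩ : Q.frobenioid))
    (hw' : w' ∈ PreFrobenioid.endSubmonoid Q.structureFunctor (⟨cQ (N k), c⟩ : Q.frobenioid))
    (h : ε (cQ (N k)) ((Q.resK _ (ModelFrobenioid.unit w') : (Q.fld (cQ (N k)))ˣ) : Q.fld (cQ (N k))) =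
      (aug g) (ε (cQ (N k)) ((Q.resK _ (ModelFrobenioid.unit w) : (Q.fld (cQ (N k)))ˣ) : Q.fld (cQ (N k))))) :
    ε (cQ (N₂ k)) ((Q.base.map (j k ≫ e ⟨cQ (N k), c⟩)).alg
        ((Q.resK _ (ModelFrobenioid.unit (Ψ.functor.map w')) : (Q.fld _)ˣ) : Q.fld _)) =
      (aug (φ g)) (ε (cQ (N₂ k)) ((Q.base.map (j k ≫ e ⟨cQ (N k), c⟩)).alg
        ((Q.resK _ (ModelFrobenioid.unit (Ψ.functor.map w)) : (Q.fld _)ˣ) : Q.fld _))) := by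
  -- the lift of the deck transformation `r_g`
  let ρ : (⟨cQ (N k), c⟩ : Q.frobenioid) ⟶ ⟨cQ (N k), c⟩ :=
    ModelFrobenioid.mkHom _ _ 1 (crightMul (N k) g) 1 1 (lift_rel Q ⟨cQ (N k), c⟩ (crightMul (N k) g) c
      (pullGp_endo Q (crightMul (N k) g) c).symm)
  have hsq : ρ ≫ w = w' ≫ ρ :=
    comp_eq_of_eps_eq d aug Q ε hεi hε ρ (isLinear_mkHom_one Q _ _ _ _) g (pt_crightMul _ _) hw hw' h
  rw [reading_natural Q Ψ ΨBase η hdeg e he ρ (isLinear_mkHom_one Q _ _ _ _) hw hw' hsq (j k) (j k)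
    (crightMul (N₂ k) (φ g)) (hφ k g).symm, hε _ (φ g) (pt_crightMul _ _)]

include η hdeg in
/-- **Multiplicativity** of the reading on `O^▷(X_k)` (`u_{β∘α} = u_β·u_α`, `Ψ` a functor).
[cite: MochizukiFrdII2008, Thm 1.2 (v) p.10] -/
theorem reading_mul [ΨBase.Faithful] (k : ℕ) (c : Algebra.GrothendieckGroup (Q.Φ.obj (op (cQ (N k)))))
    {w₁ w₂ : (⟨cQ (N k), c⟩ : Q.frobenioid) ⟶ ⟨cQ (N k), c⟩}
    (hw₁ : w₁ ∈ PreFrobenioid.endSubmonoid Q.structureFunctor (⟨cQ (N k), c⟩ : Q.frobenioid))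
    (hw₂ : w₂ ∈ PreFrobenioid.endSubmonoid Q.structureFunctor (⟨cQ (N k), c⟩ : Q.frobenioid)) :
    ε (cQ (N₂ k)) ((Q.base.map (j k ≫ e ⟨cQ (N k), c⟩)).alg
        ((Q.resK _ (ModelFrobenioid.unit (Ψ.functor.map (w₂ ≫ w₁))) : (Q.fld _)ˣ) : Q.fld _)) =
      ε (cQ (N₂ k)) ((Q.base.map (j k ≫ e ⟨cQ (N k), c⟩)).alg
          ((Q.resK _ (ModelFrobenioid.unit (Ψ.functor.map w₁)) : (Q.fld _)ˣ) : Q.fld _)) *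
        ε (cQ (N₂ k)) ((Q.base.map (j k ≫ e ⟨cQ (N k), c⟩)).alg
          ((Q.resK _ (ModelFrobenioid.unit (Ψ.functor.map w₂)) : (Q.fld _)ˣ) : Q.fld _)) := by
  rw [Ψ.functor.map_comp, Q.unit_comp_of_mem ((Q.map_mem_endSubmonoid_iff Ψ ΨBase η hdeg w₁).mpr hw₁)
    ((Q.map_mem_endSubmonoid_iff Ψ ΨBase η hdeg w₂).mpr hw₂), map_mul, Units.val_mul, map_mul, map_mul]

include η hdeg hεi in
/-- **Injectivity** of the reading on `O^▷(X_k)` (field maps and `ε` are injective, `O^▷(A) → K_A^×` is injective, `Ψ`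
is faithful). [cite: MochizukiFrdII2008, Thm 1.2 (v) p.10] -/
theorem eq_of_reading_eq [ΨBase.Faithful] (k : ℕ) (c : Algebra.GrothendieckGroup (Q.Φ.obj (op (cQ (N k)))))
    {w₁ w₂ : (⟨cQ (N k), c⟩ : Q.frobenioid) ⟶ ⟨cQ (N k), c⟩}
    (hw₁ : w₁ ∈ PreFrobenioid.endSubmonoid Q.structureFunctor (⟨cQ (N k), c⟩ : Q.frobenioid))
    (hw₂ : w₂ ∈ PreFrobenioid.endSubmonoid Q.structureFunctor (⟨cQ (N k), c⟩ : Q.frobenioid))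
    (h : ε (cQ (N₂ k)) ((Q.base.map (j k ≫ e ⟨cQ (N k), c⟩)).alg
        ((Q.resK _ (ModelFrobenioid.unit (Ψ.functor.map w₁)) : (Q.fld _)ˣ) : Q.fld _)) =
      ε (cQ (N₂ k)) ((Q.base.map (j k ≫ e ⟨cQ (N k), c⟩)).alg
        ((Q.resK _ (ModelFrobenioid.unit (Ψ.functor.map w₂)) : (Q.fld _)ˣ) : Q.fld _))) :
    w₁ = w₂ := by
  have h1 := (Q.base.map (j k ≫ e ⟨cQ (N k), c⟩)).alg.injective (hεi _ h)
  exact Ψ.functor.map_injective (Q.eq_of_mem_of_resK_unit_eq ((Q.map_mem_endSubmonoid_iff Ψ ΨBase η hdeg w₁).mpr hw₁)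
    ((Q.map_mem_endSubmonoid_iff Ψ ΨBase η hdeg w₂).mpr hw₂) (Units.ext h1))

omit [Fact p.Prime] in
/-- An injective ring homomorphism detects the powers of `p`. [folklore] -/
private theorem map_eq_natCast_pow_iff {R S : Type*} [Semiring R] [Semiring S] (ρ : R →+* S) (hρ : Injective ρ) (z : R)
    (q m : ℕ) : ρ z = (q : S) ^ m ↔ z = (q : R) ^ m := by
  constructor
  · intro h
    apply hρ
    rw [h, map_pow, map_natCast]
  · intro h
    rw [h, map_pow, map_natCast]

include η hdeg in
/-- **The link with the original object.**  Let `X` be any object of `C_v`, `N_k ⊆ Base(X)`, `π_k : Π_v/N_k → Base(X)` the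
projection, `X_k = (Π_v/N_k, π_k^* cls X)` and `λ_k = (1, π_k, 0, 1) : X_k → X`.  For `w ∈ O^▷(X)` with restriction
`w_k ∈ O^▷(X_k)`: the rational function of `Ψ w` is `p^m` iff the reading of `w_k` at level `k` is `p^m` (the rational
function of `Ψ w_k` is that of `Ψ w` moved by an injective ring homomorphism fixing `p`).
([IUTchI] Ex 3.3 (iii) (e) p.79) [claim: Mochizuki2012, status: disputed] -/
theorem resK_unit_map_eq_pow_iff [ΨBase.Faithful] (X : Q.frobenioid) (k : ℕ) (hk : (N k).toOpenSubgroup ≤ X.base.sg)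
    {w : X ⟶ X} (hw : w ∈ PreFrobenioid.endSubmonoid Q.structureFunctor X)
    {wk : (⟨cQ (N k), pullGp Q.Φ (CosetCat.homMk ((1 : P) : X.base.carrier) (proj_wd X.base (N k) hk)) X.cls⟩ : Q.frobenioid) ⟶
      ⟨cQ (N k), pullGp Q.Φ (CosetCat.homMk ((1 : P) : X.base.carrier) (proj_wd X.base (N k) hk)) X.cls⟩}
    (hwk : wk ∈ PreFrobenioid.endSubmonoid Q.structureFunctor
      (⟨cQ (N k), pullGp Q.Φ (CosetCat.homMk ((1 : P) : X.base.carrier) (proj_wd X.base (N k) hk)) X.cls⟩ : Q.frobenioid))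
    (hsq : ModelFrobenioid.mkHom
        (⟨cQ (N k), pullGp Q.Φ (CosetCat.homMk ((1 : P) : X.base.carrier) (proj_wd X.base (N k) hk)) X.cls⟩ : Q.frobenioid) X 1
        (CosetCat.homMk ((1 : P) : X.base.carrier) (proj_wd X.base (N k) hk)) 1 1 (lift_rel Q X _ _ rfl) ≫ w =
      wk ≫ ModelFrobenioid.mkHom
        (⟨cQ (N k), pullGp Q.Φ (CosetCat.homMk ((1 : P) : X.base.carrier) (proj_wd X.base (N k) hk)) X.cls⟩ : Q.frobenioid) X 1
        (CosetCat.homMk ((1 : P) : X.base.carrier) (proj_wd X.base (N k) hk)) 1 1 (lift_rel Q X _ _ rfl))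
    (m : ℕ) :
    Q.resK _ (ModelFrobenioid.unit (Ψ.functor.map w)) = Q.primeUnit (Ψ.functor.obj X).base ^ m ↔
      ε (cQ (N₂ k)) ((Q.base.map (j k ≫ e ⟨cQ (N k), pullGp Q.Φ (CosetCat.homMk ((1 : P) : X.base.carrier)
          (proj_wd X.base (N k) hk)) X.cls⟩)).alg
        ((Q.resK _ (ModelFrobenioid.unit (Ψ.functor.map wk)) : (Q.fld _)ˣ) : Q.fld _)) = ((p : ℕ) : d.Ω) ^ m := by
  have hu := Q.resK_unit_map_eq_of_comp_eq Ψ ΨBase η hdeg _ (isLinear_mkHom_one Q _ _ _ _) hw hwk hsq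
  rw [hu, Units.coe_map, MonoidHom.coe_coe, Units.ext_iff, Units.val_pow_eq_pow_val, Datum.coe_primeUnit,
    ← RingHom.comp_apply, ← RingHom.comp_apply]
  exact (map_eq_natCast_pow_iff _ (RingHom.injective _) _ p m).symm

end Tower


end UnitTransport

end GoodLocalFrobenioid

end Literature.IUT.HodgeTheaters

end
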